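import Summits.Ventures.PercRepro.MSTightExtSide
import Summits.Ventures.PercRepro.MSTightDownSetSupport
import Summits.Ventures.PercRepro.MSTightBadExtensionPartner

/-!
# Theorem (i) TightExt in its main case, coordinate-free

Dossier proofs/MINE1-theoremS.md, Addendum 54 supplement 2. The kernel assembly of Theorem (i)
(`extension_side_of_cover`, p511488) takes two comparability hypotheses: every `P₁`-eligible
member lies below a member of the tight extension `T = insert m K`, every `P₀`-eligible member
above one. Addendum 52 §4 (b) proves them in coordinates outside two exceptional shapes. Here they
are proved coordinate-free from Theorem S's flip along the addable part `R = Rstar T`: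

* `union_Rstar_mem_of_sdiff_mem`: if `k₀ ⊆ R` and `p \ k₀` is a difference of `T`,
  then `p ∪ R ∈ T` (so `p` lies below a member) — `p \ R = (p \ k₀) \ R` is a twin-closed subset
  of a flip member;
* `inter_Rstar_mem_of_sdiff_mem`: if `k₁ ⊇ R` and `k₁ \ p` is a difference of `T`,
  then `p ∩ R ∈ T` (so `p` lies above a member) — `R \ p = (k₁ \ p) ∩ R`.

Hence `extension_side_of_cover_of_Rstar`: Theorem (i) holds whenever `K` has a member inside
`Rstar (insert m K)` and a member containing it — i.e. outside the column / row exceptions of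
Addendum 52 §4 (d), in which `m = Rstar (insert m K)` is the unique member of `insert m K` inside
(resp. containing) the addable part.
-/

namespace PercRepro.MSTight

open Finset
open scoped FinsetFamily symmDiff

variable {α : Type*} [DecidableEq α] [Fintype α]

/-- A set whose difference against a member inside the addable part is a difference lies below
the member `p ∪ Rstar T`. -/
theorem union_Rstar_mem_of_sdiff_mem {T : Finset (Finset α)} (hT : Tight T) {k₀ : Finset α}
    (hk₀R : k₀ ⊆ Rstar T) {p : Finset α} (hp : p \ k₀ ∈ T \\ T) :
    p ∪ Rstar T ∈ T := by
  set R := Rstar T with hR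
  have hD := dichotomy_of_tight hT
  rw [diffs_eq_flip_of_tight hT] at hp
  have h1 : (p \ k₀) \ R ∈ flip R T :=
    mem_flip_of_subset_of_twinClosed hD hp sdiff_subset
      ((twinClosed_of_mem_flip hp).sdiff (twinClosed_Rstar T))
  have e1 : (p \ k₀) \ R = p \ R := by
    ext x
    simp only [mem_sdiff]
    constructor
    · rintro ⟨⟨hxp, -⟩, hxR⟩
      exact ⟨hxp, hxR⟩
    · rintro ⟨hxp, hxR⟩
      exact ⟨⟨hxp, fun h => hxR (hk₀R h)⟩, hxR⟩
  rw [e1] at h1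
  obtain ⟨A, hA, hAR⟩ := mem_flip.1 h1
  have e2 : A = p ∪ R := by
    apply eq_of_symmDiff_eq (R := R)
    rw [hAR]
    ext x
    simp only [mem_symmDiff, mem_sdiff, mem_union]
    constructor
    · rintro ⟨hxp, hxR⟩
      exact Or.inl ⟨Or.inl hxp, hxR⟩
    · rintro (⟨hx | hx, hxR⟩ | ⟨hxR, hx⟩)
      · exact ⟨hx, hxR⟩
      · exact absurd hx hxR
      · exact absurd (Or.inr hxR) hx
  rw [← e2]
  exact hA

/-- A set whose difference from a member containing the addable part is a difference lies above
the member `p ∩ Rstar T`. -/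
theorem inter_Rstar_mem_of_sdiff_mem {T : Finset (Finset α)} (hT : Tight T) {k₁ : Finset α}
    (hRk : Rstar T ⊆ k₁) {p : Finset α} (hp : k₁ \ p ∈ T \\ T) :
    p ∩ Rstar T ∈ T := by
  set R := Rstar T with hR
  have hD := dichotomy_of_tight hT
  rw [diffs_eq_flip_of_tight hT] at hp
  have h1 : (k₁ \ p) ∩ R ∈ flip R T :=
    mem_flip_of_subset_of_twinClosed hD hp inter_subset_left
      ((twinClosed_of_mem_flip hp).inter (twinClosed_Rstar T))
  have e1 : (k₁ \ p) ∩ R = R \ p := by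
    ext x
    simp only [mem_sdiff, mem_inter]
    constructor
    · rintro ⟨⟨-, hxp⟩, hxR⟩
      exact ⟨hxR, hxp⟩
    · rintro ⟨hxR, hxp⟩
      exact ⟨⟨hRk hxR, hxp⟩, hxR⟩
  rw [e1] at h1
  obtain ⟨A, hA, hAR⟩ := mem_flip.1 h1
  have e2 : A = p ∩ R := by
    apply eq_of_symmDiff_eq (R := R)
    rw [hAR]
    ext x
    simp only [mem_symmDiff, mem_sdiff, mem_inter]
    constructor
    · rintro ⟨hxR, hxp⟩
      exact Or.inr ⟨hxR, fun h => hxp h.1⟩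
    · rintro (⟨⟨hxp, hxR⟩, hxR'⟩ | ⟨hxR, hx⟩)
      · exact absurd hxR hxR'
      · exact ⟨hxR, fun hxp => hx ⟨hxp, hxR⟩⟩
  rw [← e2]
  exact hA

/-- **Theorem (i) TightExt, main case.** For a tight `P`, `K ⊆ P` covering, `m ∈ P` with
`T = insert m K` tight and `D(T)` a down-set, if `K` has a member inside `Rstar T` and a member
containing `Rstar T`, then one eligible side of `P ∖ K` is contained in `{m}`. -/
theorem extension_side_of_cover_of_Rstar {P K : Finset (Finset α)} {m : Finset α} (hP : Tight P)
    (hT : Tight (insert m K)) (hD : IsDownSet (insert m K \\ insert m K)) (hmP : m ∈ P)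
    (hKP : K ⊆ P)
    (hcov : ∀ p ∈ P, p ∉ K → (∀ k ∈ K, p \ k ∈ K \\ K) ∨ (∀ k ∈ K, k \ p ∈ K \\ K))
    (hk₀ : ∃ k₀ ∈ K, k₀ ⊆ Rstar (insert m K)) (hk₁ : ∃ k₁ ∈ K, Rstar (insert m K) ⊆ k₁) :
    (∀ p ∈ P, p ∉ K → (∀ k ∈ K, p \ k ∈ K \\ K) → p = m) ∨
      (∀ p ∈ P, p ∉ K → (∀ k ∈ K, k \ p ∈ K \\ K) → p = m) := by
  have hsub : K \\ K ⊆ insert m K \\ insert m K :=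
    diffs_subset (subset_insert m K) (subset_insert m K)
  refine extension_side_of_cover hP hT hD hmP hKP hcov ?_ ?_
  · intro p _ hp
    obtain ⟨k₀, hk₀K, hk₀R⟩ := hk₀
    exact ⟨p ∪ Rstar (insert m K),
      union_Rstar_mem_of_sdiff_mem hT hk₀R (hsub (hp k₀ hk₀K)),
      subset_union_left⟩
  · intro p _ hp
    obtain ⟨k₁, hk₁K, hRk⟩ := hk₁
    exact ⟨p ∩ Rstar (insert m K),
      inter_Rstar_mem_of_sdiff_mem hT hRk (hsub (hp k₁ hk₁K)),
      inter_subset_left⟩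

/-- **Theorem (i), main case, for a covering `K` twin-free on its support** (the down-set
hypothesis discharged by `isDownSet_diffs_insert_of_ext`). -/
theorem extension_side_of_cover_of_Rstar' {P K : Finset (Finset α)} {m : Finset α} (hP : Tight P)
    (hT : Tight (insert m K)) (hmP : m ∈ P) (hKP : K ⊆ P) (hne : K.Nonempty)
    (hKtf : ∀ a b, (∃ k ∈ K, a ∈ k) → (∃ k ∈ K, a ∉ k) → Twin K a b → a = b)
    (hm1 : ∀ k ∈ K, m \ k ∈ K \\ K) (hm0 : ∀ k ∈ K, k \ m ∈ K \\ K)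
    (hcov : ∀ p ∈ P, p ∉ K → (∀ k ∈ K, p \ k ∈ K \\ K) ∨ (∀ k ∈ K, k \ p ∈ K \\ K))
    (hk₀ : ∃ k₀ ∈ K, k₀ ⊆ Rstar (insert m K)) (hk₁ : ∃ k₁ ∈ K, Rstar (insert m K) ⊆ k₁) :
    (∀ p ∈ P, p ∉ K → (∀ k ∈ K, p \ k ∈ K \\ K) → p = m) ∨
      (∀ p ∈ P, p ∉ K → (∀ k ∈ K, k \ p ∈ K \\ K) → p = m) :=
  extension_side_of_cover_of_Rstar hP hT (isDownSet_diffs_insert_of_ext hT hm1 hm0 hne hKtf) hmP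
    hKP hcov hk₀ hk₁

end PercRepro.MSTight
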